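import Summits.QuantumFields.BalabanUV.T4Continuum.Support.NE3FrameFreeDecompositionLinear
import Summits.QuantumFields.BalabanUV.T4Continuum.Support.NE3CornerGaugePoincare
import Summits.QuantumFields.BalabanUV.T4Continuum.Support.NE3BlockPoincareTangent
import Summits.QuantumFields.BalabanUV.T4Continuum.Support.NE3CurvedFrameKill
import Summits.QuantumFields.BalabanUV.T4Continuum.Support.NE3EnergyWeightedShapes
import Summits.QuantumFields.BalabanUV.T4Continuum.Support.NE3SmoothLiftW
import Summits.QuantumFields.BalabanUV.T4Continuum.Support.NE7TraceLinkHessianLower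
import HarnessLib

/-!
# NE7 (pub-balaban, rung (B)+1): THE ENERGY MASSES `m₂, p₂` OF THE SLICE CORRECTOR OF A FRAME-FREE RESIDUAL — SUP-3 of the merged ENDs, Pythagoras + K6-Ξ

Cell `pub-balaban`, rung (B)+1 sub-cell t4, lineage `b2b-balaban-t4-ne7-p1` (CRUX PROVER NE7 #1 = OWNER of row NE7), generation 98; memo `t4/b2b-balaban-t4-ne7-p1-g98/ROAD-G98.md` §3.3∕§3.4.

WHY.  The ENDs of record (`NE7HintOfDbarSU2M4.hint_SU2_of_dbar_M4`, merged per-pair form) ask, for the representative's tangent residual `Y` and every corner-trivial skew periodic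
`μ` with `Y + D_Wμ ∈ T_♮(W)`, the masses `dirSq (D_W μ) ≤ m₂M²‖X‖_w²`, `Σ‖μ‖² ≤ p₂M⁴‖X‖_w²` (and the quartic ℓ¹ line).  THIS FILE is the MECHANISM behind `m₂, p₂` (memo §3.3 SUP-3, sizes
of §3.4) in the case the residual is FRAME-FREE (`framePotW L (j+1) W Y = 0`; ROAD-Γ′ reaches it by killing the accumulated frame exactly in the spike part): then the corrector `μ`
has vanishing nested block mean (`bmeanIterW μ = 0`, by the curved (‡) `framePotW_gaugeDir`), so `μ ∈ Ξ₀₀(W)`, and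
* PYTHAGORAS on `T_♮(W) ⊥ D_W Ξ₀₀(W)` (`NE3FrameFreeSliceW.sum_nhsNormSq_add_gaugeDir_eq_of_mem`): `Σ nhs(D_Wμ) ≤ Σ nhs(Y)` over the period box;
* K6-Ξ corner Poincaré (`NE3CornerGaugePoincare.sum_nhsNormSq_le_four_mul_of_bmeanIterW_eq_zero`): `Σ nhs(μ) ≤ 4M²·Σ nhs(D_Wμ)`;
* currencies (`nhsNormSq ≤ ‖·‖² ≤ card n · nhsNormSq`, `dirSq ≤ M²‖·‖_w²`): **`dirSq (D_Wμ) ≤ card n·M²·‖Y‖_w²`**, **`Σ‖μ(z)‖² ≤ 4·card n·M⁴·‖Y‖_w²`** — the END's `m₂∕p₂` shapes with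
  `‖Y‖_w` in place of `‖X‖_w`; the supplier closes with its residual letter `‖Y‖_w ≤ c·(M·b)·‖X‖_w` (memo §3.3 (r-E)), giving `m₂ = card n·c²(Mb)²`, `p₂ = 4·card n·c²(Mb)²`.

HONEST FRAMING (page 1): real arithmetic over landed kernel theorems; nothing of Bałaban's asserted; NE7 NOT PROVED; spine 0∕9; finite T⁴ rung (B)+1 — NOT infinite volume, NOT mass gap,
NOT `BetaPertH`, NOT Clay.  Continuum YM on T⁴ ⇐ BetaPertH ∧ nine spine estimates (0/9 proved).

WHAT ([folklore]; 0 def, 0 sorry).  §1 `bmeanIterW_eq_zero_of_corrector` (frame-free residual ⇒ the corrector has zero nested mean), `corrector_mem_cornerGaugeSpaceW`;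
§2 `sum_nhs_gaugeDir_corrector_le` (Pythagoras), `sum_nhs_corrector_le` (K6-Ξ); §3 `sum_nhs_le_sq_energyNormW`, `dirSq_gaugeDir_corrector_le`, `sum_normSq_corrector_le` (the END's currencies).
-/

namespace Summit.QuantumFields.BalabanUV.T4Continuum.NE7CorrectorEnergyMasses

open scoped BigOperators Matrix Matrix.Norms.L2Operator
open Finset

open Literature.MathematicalPhysics.QuantumFieldTheory.Balaban1983to89
open B7Prop1Explicit B7Prop2Explicit MatrixNorms
open T4AveragingDeficitWall (IsUnitaryCfg IsSkewDir SmallField dirSq curlSq)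
open T4AveragingDeficitWallBoundary (IsPeriodicCfg periodBox)
open AveragingDeficitPeriodicCounting (IsPeriodicDir)
open AveragingDeficitTwoLevelPrep (prop1Radius)
open AveragingDeficitMultiLevelPrep (LevelSmall tower)
open BlockAveragePushDirGauge (gaugeDir)
open NE3CovariantBlockMean (bmeanIterW framePotW_gaugeDir)
open NE3TangentCovariantTower (framePotW)
open NE3FrameFreeSliceW (frameFreeBlockLandauW cornerGaugeSpaceW mem_cornerGaugeSpaceW_iff sum_nhsNormSq_add_gaugeDir_eq_of_mem)
open NE3CurvedCornerGaugeSpace (mem_cornerGaugeSpace₀_iff)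
open NE3CornerGaugePoincare (sum_nhsNormSq_le_four_mul_of_bmeanIterW_eq_zero)
open NE3BlockPoincareTangent (dirSq_le_card_mul_sum_nhs)
open NE3CurvedFrameKill (framePotW_add)
open NE3CovariantCalculus (nhsNormSq_neg)
open NE3EnergyWeightedShapes (energyNormW)
open NE3SmoothLiftW (tower_eq_pow_mul)
open NE7TraceLinkHessianLower (norm_sq_le_card_mul_nhsNormSq)
open NE3EnergyHessContTwoTerm (curlSq_nonneg dirSq_nonneg)
open SpreadLift (loopRad)

noncomputable section

variable {d : ℕ} {n : Type*} [Fintype n] [DecidableEq n]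

/-! ## §1 A frame-free residual forces a corrector with zero nested block mean -/

section Class

variable [Nonempty n] {L N : ℕ} [NeZero N] (hL : 2 ≤ L) (j : ℕ) {W : Site d → Fin d → (Matrix n n ℂ)ˣ} {x : ℝ}
  (hWu : IsUnitaryCfg W) (hWP : IsPeriodicCfg W ((tower L N (j + 1) : ℕ) : ℤ)) (hx : 0 ≤ x) (hsm : LevelSmall d L j x) (hWx : SmallField W x)
  {Y : Site d → Fin d → Matrix n n ℂ} (hYff : ∀ z : Site d, framePotW L (j + 1) W Y z = 0)
  {mu : Site d → Matrix n n ℂ} (hmus : ∀ y, mu y ∈ skewAdjoint (Matrix n n ℂ))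
  (hmuP : ∀ (y : Site d) (i : Fin d), mu (y + ((tower L N (j + 1) : ℕ) : ℤ) • e i) = mu y)
  (hmu0 : ∀ w : Site d, mu (((L : ℤ) ^ (j + 1)) • w) = 0)
  (hmem : (fun y ν => Y y ν + gaugeDir W mu y ν) ∈ frameFreeBlockLandauW (d := d) (n := n) L N (j + 1) W)

include hL hWu hWP hx hsm hWx hYff hmus hmuP hmu0 hmem in
/-- **FRAME-FREE RESIDUAL ⇒ THE CORRECTOR HAS ZERO NESTED BLOCK MEAN**: `framePotW (Y + D_Wμ) = 0` (slice), `framePotW Y = 0` (hypothesis), additivity and the curved (‡)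
`framePotW (D_Wμ)(z) = μ(M•z) − bmeanIterW μ (z)` with `μ(M•z) = 0` give `bmeanIterW L (j+1) W μ = 0`. [folklore] -/
theorem bmeanIterW_eq_zero_of_corrector : bmeanIterW L (j + 1) W mu = 0 := by
  have hL1 : 1 ≤ L := by omega
  funext z
  have hslice := hmem.2.2.2.1 z
  rw [framePotW_add hL1 j hWu hx hsm hWx Y (gaugeDir W mu) z, hYff z, zero_add,
    framePotW_gaugeDir (M := N) hL1 j hWu hWP hx hsm hWx hmus hmuP z, hmu0 z, zero_sub, neg_eq_zero] at hslice
  rw [hslice]; rfl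

include hL hWu hWP hx hsm hWx hYff hmus hmuP hmu0 hmem in
/-- Hence the corrector lies in `Ξ₀₀(W)` (periodic, corner-trivial, skew, zero nested mean). [folklore] -/
theorem corrector_mem_cornerGaugeSpaceW : mu ∈ cornerGaugeSpaceW (d := d) (n := n) L (j + 1) W (tower L N (j + 1)) (L ^ (j + 1)) := by
  refine mem_cornerGaugeSpaceW_iff.mpr ⟨mem_cornerGaugeSpace₀_iff.mpr ⟨fun y κ => hmuP y κ, fun w => ?_, hmus⟩,
    bmeanIterW_eq_zero_of_corrector hL j hWu hWP hx hsm hWx hYff hmus hmuP hmu0 hmem⟩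
  have : ((L ^ (j + 1) : ℕ) : ℤ) • w = ((L : ℤ) ^ (j + 1)) • w := by push_cast; rfl
  rw [this]; exact hmu0 w

/-! ## §2 Pythagoras and the corner Poincaré inequality -/

include hL hWu hWP hx hsm hWx hYff hmus hmuP hmu0 hmem in
/-- **PYTHAGORAS**: `Σ_{periodBox} Σ_κ nhs (D_Wμ) ≤ Σ Σ nhs (Y)` — `Y = X_T − D_Wμ` with `X_T ∈ T_♮(W) ⊥ D_W Ξ₀₀(W)` and `μ ∈ Ξ₀₀(W)`. [folklore] -/
theorem sum_nhs_gaugeDir_corrector_le :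
    ∑ y ∈ periodBox (d := d) (tower L N (j + 1)), ∑ κ : Fin d, nhsNormSq (gaugeDir W mu y κ)
      ≤ ∑ y ∈ periodBox (d := d) (tower L N (j + 1)), ∑ κ : Fin d, nhsNormSq (Y y κ) := by
  have hμ := corrector_mem_cornerGaugeSpaceW hL j hWu hWP hx hsm hWx hYff hmus hmuP hmu0 hmem
  have hneg : (fun y => -mu y) ∈ cornerGaugeSpaceW (d := d) (n := n) L (j + 1) W (tower L N (j + 1)) (L ^ (j + 1)) :=
    (cornerGaugeSpaceW (d := d) (n := n) L (j + 1) W (tower L N (j + 1)) (L ^ (j + 1))).neg_mem hμ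
  have h := sum_nhsNormSq_add_gaugeDir_eq_of_mem hmem hneg
  have hgd : ∀ y κ, gaugeDir W (fun y => -mu y) y κ = -gaugeDir W mu y κ := fun y κ => by
    simp [gaugeDir, T4AveragingDeficitWall.Ad]; abel
  have hY : ∀ y κ, (fun y ν => Y y ν + gaugeDir W mu y ν) y κ + gaugeDir W (fun y => -mu y) y κ = Y y κ := fun y κ => by
    rw [hgd]; simp
  simp_rw [hY, hgd, nhsNormSq_neg] at h
  have h0 : 0 ≤ ∑ y ∈ periodBox (d := d) (tower L N (j + 1)), ∑ κ : Fin d, nhsNormSq ((fun y ν => Y y ν + gaugeDir W mu y ν) y κ) :=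
    sum_nonneg fun _ _ => sum_nonneg fun _ _ => nhsNormSq_nonneg _
  linarith

include hL hWu hWP hx hsm hWx hYff hmus hmuP hmu0 hmem in
/-- **K6-Ξ FOR THE CORRECTOR**: `Σ_{periodBox} nhs (μ) ≤ 4M²·Σ Σ nhs (Y)` (corner Poincaré for generators of zero nested mean, then Pythagoras), under the K6 smallness line. [folklore] -/
theorem sum_nhs_corrector_le
    (hsmall : 8 * d * (((L : ℝ) ^ (j + 1)) * (((d : ℝ) - 1) * (((L : ℝ) ^ (j + 1)) - 1) * x)) ^ 2
      + 2 * (Fintype.card n * (4 * (d : ℝ) ^ 2 * ((L : ℝ) ^ (j + 1) - 1) ^ 2 * x + 16 * d * loopRad d L ((prop1Radius d L)^[j] x)) ^ 2) ≤ 1 / 2) :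
    ∑ y ∈ periodBox (d := d) (tower L N (j + 1)), nhsNormSq (mu y)
      ≤ 4 * ((L : ℝ) ^ (j + 1)) ^ 2 * ∑ y ∈ periodBox (d := d) (tower L N (j + 1)), ∑ κ : Fin d, nhsNormSq (Y y κ) := by
  have hbm := bmeanIterW_eq_zero_of_corrector hL j hWu hWP hx hsm hWx hYff hmus hmuP hmu0 hmem
  have hP := sum_nhsNormSq_le_four_mul_of_bmeanIterW_eq_zero hL j hWu hx hsm hWx N mu (fun z _ => by rw [hbm]; rfl) hsmall
  have hPy := sum_nhs_gaugeDir_corrector_le hL j hWu hWP hx hsm hWx hYff hmus hmuP hmu0 hmem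
  have ht : tower L N (j + 1) = L ^ (j + 1) * N := tower_eq_pow_mul L N (j + 1)
  rw [ht] at hPy ⊢
  have hM : 0 ≤ 4 * ((L : ℝ) ^ (j + 1)) ^ 2 := by positivity
  calc ∑ y ∈ periodBox (d := d) (L ^ (j + 1) * N), nhsNormSq (mu y)
      ≤ 4 * (((L : ℝ) ^ (j + 1)) ^ 2 * ∑ y ∈ periodBox (d := d) (L ^ (j + 1) * N), ∑ μ : Fin d, nhsNormSq (gaugeDir W mu y μ)) := hP
    _ ≤ 4 * ((L : ℝ) ^ (j + 1)) ^ 2 * ∑ y ∈ periodBox (d := d) (L ^ (j + 1) * N), ∑ κ : Fin d, nhsNormSq (Y y κ) := by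
        rw [← mul_assoc]; exact mul_le_mul_of_nonneg_left hPy hM

/-! ## §3 The END's currencies: `dirSq (D_Wμ) ≤ card n·M²·‖Y‖_w²`, `Σ‖μ‖² ≤ 4·card n·M⁴·‖Y‖_w²` -/

include hL in
omit [Nonempty n] [NeZero N] in
/-- `Σ Σ nhs (Y) ≤ dirSq Y ≤ M²·‖Y‖_w²`. [folklore] -/
theorem sum_nhs_le_sq_energyNormW (F : Finset (Site d)) :
    ∑ y ∈ F, ∑ κ : Fin d, nhsNormSq (Y y κ) ≤ ((L : ℝ) ^ (j + 1)) ^ 2 * energyNormW L (j + 1) W Y F ^ 2 := by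
  have hL' : ∑ y ∈ F, ∑ κ : Fin d, nhsNormSq (Y y κ) ≤ dirSq Y F := by
    unfold dirSq
    exact sum_le_sum fun y _ => sum_le_sum fun κ _ => nhsNormSq_le_opNorm_sq _
  have hE : energyNormW L (j + 1) W Y F ^ 2 = curlSq W Y F + ((((L : ℝ) ^ (j + 1)))⁻¹) ^ 2 * dirSq Y F := by
    unfold energyNormW
    rw [Real.sq_sqrt (add_nonneg (curlSq_nonneg W Y F) (mul_nonneg (sq_nonneg _) (dirSq_nonneg Y F)))]
  have hM0 : (0 : ℝ) < ((L : ℝ) ^ (j + 1)) ^ 2 := by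
    have : (0 : ℝ) < (L : ℝ) := by exact_mod_cast (show 0 < L by omega)
    positivity
  have hdir : dirSq Y F ≤ ((L : ℝ) ^ (j + 1)) ^ 2 * energyNormW L (j + 1) W Y F ^ 2 := by
    rw [hE, mul_add]
    have hMne : ((L : ℝ) ^ (j + 1)) ^ 2 ≠ 0 := ne_of_gt hM0
    have h1 : ((L : ℝ) ^ (j + 1)) ^ 2 * (((((L : ℝ) ^ (j + 1)))⁻¹) ^ 2 * dirSq Y F) = dirSq Y F := by
      rw [← mul_assoc, inv_pow, mul_inv_cancel₀ hMne, one_mul]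
    rw [h1]
    linarith [mul_nonneg hM0.le (curlSq_nonneg W Y F)]
  exact hL'.trans hdir

include hL hWu hWP hx hsm hWx hYff hmus hmuP hmu0 hmem in
/-- **THE `m₂`-SHAPE**: `dirSq (D_Wμ) (periodBox) ≤ card n·M²·‖Y‖_w²`. [folklore] -/
theorem dirSq_gaugeDir_corrector_le :
    dirSq (gaugeDir W mu) (periodBox (d := d) (tower L N (j + 1)))
      ≤ (Fintype.card n : ℝ) * ((L : ℝ) ^ (j + 1)) ^ 2 * energyNormW L (j + 1) W Y (periodBox (d := d) (tower L N (j + 1))) ^ 2 := by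
  have h1 := dirSq_le_card_mul_sum_nhs (gaugeDir W mu) (periodBox (d := d) (tower L N (j + 1)))
  have h2 := sum_nhs_gaugeDir_corrector_le hL j hWu hWP hx hsm hWx hYff hmus hmuP hmu0 hmem
  have h3 := sum_nhs_le_sq_energyNormW hL j (W := W) (Y := Y) (periodBox (d := d) (tower L N (j + 1)))
  have hn : (0 : ℝ) ≤ Fintype.card n := by positivity
  calc dirSq (gaugeDir W mu) (periodBox (d := d) (tower L N (j + 1)))
      ≤ Fintype.card n * ∑ y ∈ periodBox (d := d) (tower L N (j + 1)), ∑ κ : Fin d, nhsNormSq (gaugeDir W mu y κ) := h1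
    _ ≤ Fintype.card n * (((L : ℝ) ^ (j + 1)) ^ 2 * energyNormW L (j + 1) W Y (periodBox (d := d) (tower L N (j + 1))) ^ 2) :=
        mul_le_mul_of_nonneg_left (h2.trans h3) hn
    _ = (Fintype.card n : ℝ) * ((L : ℝ) ^ (j + 1)) ^ 2 * energyNormW L (j + 1) W Y (periodBox (d := d) (tower L N (j + 1))) ^ 2 := by ring

include hL hWu hWP hx hsm hWx hYff hmus hmuP hmu0 hmem in
/-- **THE `p₂`-SHAPE**: `Σ_{periodBox} ‖μ(z)‖² ≤ 4·card n·M⁴·‖Y‖_w²` (under the K6 smallness line). [folklore] -/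
theorem sum_normSq_corrector_le
    (hsmall : 8 * d * (((L : ℝ) ^ (j + 1)) * (((d : ℝ) - 1) * (((L : ℝ) ^ (j + 1)) - 1) * x)) ^ 2
      + 2 * (Fintype.card n * (4 * (d : ℝ) ^ 2 * ((L : ℝ) ^ (j + 1) - 1) ^ 2 * x + 16 * d * loopRad d L ((prop1Radius d L)^[j] x)) ^ 2) ≤ 1 / 2) :
    ∑ z ∈ periodBox (d := d) (tower L N (j + 1)), ‖mu z‖ ^ 2
      ≤ 4 * (Fintype.card n : ℝ) * (((L : ℝ) ^ (j + 1)) ^ 2) ^ 2 * energyNormW L (j + 1) W Y (periodBox (d := d) (tower L N (j + 1))) ^ 2 := by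
  have h1 : ∑ z ∈ periodBox (d := d) (tower L N (j + 1)), ‖mu z‖ ^ 2 ≤ (Fintype.card n : ℝ) * ∑ z ∈ periodBox (d := d) (tower L N (j + 1)), nhsNormSq (mu z) := by
    rw [Finset.mul_sum]
    exact sum_le_sum fun z _ => norm_sq_le_card_mul_nhsNormSq (mu z)
  have h2 := sum_nhs_corrector_le hL j hWu hWP hx hsm hWx hYff hmus hmuP hmu0 hmem hsmall
  have h3 := sum_nhs_le_sq_energyNormW hL j (W := W) (Y := Y) (periodBox (d := d) (tower L N (j + 1)))
  have hn : (0 : ℝ) ≤ Fintype.card n := by positivity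
  have hM : 0 ≤ 4 * ((L : ℝ) ^ (j + 1)) ^ 2 := by positivity
  calc ∑ z ∈ periodBox (d := d) (tower L N (j + 1)), ‖mu z‖ ^ 2
      ≤ (Fintype.card n : ℝ) * ∑ z ∈ periodBox (d := d) (tower L N (j + 1)), nhsNormSq (mu z) := h1
    _ ≤ (Fintype.card n : ℝ) * (4 * ((L : ℝ) ^ (j + 1)) ^ 2 * (((L : ℝ) ^ (j + 1)) ^ 2 * energyNormW L (j + 1) W Y (periodBox (d := d) (tower L N (j + 1))) ^ 2)) :=
        mul_le_mul_of_nonneg_left (h2.trans (mul_le_mul_of_nonneg_left h3 hM)) hn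
    _ = 4 * (Fintype.card n : ℝ) * (((L : ℝ) ^ (j + 1)) ^ 2) ^ 2 * energyNormW L (j + 1) W Y (periodBox (d := d) (tower L N (j + 1))) ^ 2 := by ring

/-! ## §4 The general residual: reduction to ANY corner-trivial frame-kill `μ_f` -/

include hL hWu hWP hx hsm hWx hmus hmuP hmu0 hmem in
omit hYff in
/-- **THE GENERAL (NOT FRAME-FREE) RESIDUAL — `m₂`-SHAPE.**  For ANY corner-trivial skew periodic `μ_f` that kills the accumulated frame of `Y` (`framePotW (Y + D_Wμ_f) = 0`; e.g. row
NE3's curved frame-kill `NE3CurvedFrameKill`), every corner-trivial corrector `μ` of `Y` satisfies `dirSq (D_Wμ) ≤ 2·card n·M²·‖Y + D_Wμ_f‖_w² + 2·dirSq (D_Wμ_f)`: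
`μ − μ_f` is a corrector of the frame-free `Y + D_Wμ_f`, to which §3 applies. [folklore] -/
theorem dirSq_gaugeDir_corrector_le_of_frameKill {mu_f : Site d → Matrix n n ℂ} (hfs : ∀ y, mu_f y ∈ skewAdjoint (Matrix n n ℂ))
    (hfP : ∀ (y : Site d) (i : Fin d), mu_f (y + ((tower L N (j + 1) : ℕ) : ℤ) • e i) = mu_f y)
    (hf0 : ∀ w : Site d, mu_f (((L : ℤ) ^ (j + 1)) • w) = 0)
    (hff : ∀ z : Site d, framePotW L (j + 1) W (fun y ν => Y y ν + gaugeDir W mu_f y ν) z = 0) :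
    dirSq (gaugeDir W mu) (periodBox (d := d) (tower L N (j + 1)))
      ≤ 2 * ((Fintype.card n : ℝ) * ((L : ℝ) ^ (j + 1)) ^ 2
            * energyNormW L (j + 1) W (fun y ν => Y y ν + gaugeDir W mu_f y ν) (periodBox (d := d) (tower L N (j + 1))) ^ 2)
        + 2 * dirSq (gaugeDir W mu_f) (periodBox (d := d) (tower L N (j + 1))) := by
  set δ : Site d → Matrix n n ℂ := fun y => mu y - mu_f y with hδ
  have hδs : ∀ y, δ y ∈ skewAdjoint (Matrix n n ℂ) := fun y => (skewAdjoint _).sub_mem (hmus y) (hfs y)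
  have hδP : ∀ (y : Site d) (i : Fin d), δ (y + ((tower L N (j + 1) : ℕ) : ℤ) • e i) = δ y := fun y i => by simp only [hδ, hmuP, hfP]
  have hδ0 : ∀ w : Site d, δ (((L : ℤ) ^ (j + 1)) • w) = 0 := fun w => by simp only [hδ, hmu0, hf0, sub_zero]
  have hgd : ∀ y κ, gaugeDir W δ y κ = gaugeDir W mu y κ - gaugeDir W mu_f y κ := fun y κ => by
    simp only [hδ, gaugeDir, T4AveragingDeficitWall.Ad, Matrix.mul_sub, Matrix.sub_mul]; abel
  have hmem' : (fun y ν => (fun y ν => Y y ν + gaugeDir W mu_f y ν) y ν + gaugeDir W δ y ν) ∈ frameFreeBlockLandauW (d := d) (n := n) L N (j + 1) W := by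
    have heq : (fun y ν => (fun y ν => Y y ν + gaugeDir W mu_f y ν) y ν + gaugeDir W δ y ν) = fun y ν => Y y ν + gaugeDir W mu y ν := by
      funext y ν; simp only [hgd]; abel
    rw [heq]; exact hmem
  have hcore := dirSq_gaugeDir_corrector_le hL j hWu hWP hx hsm hWx hff hδs hδP hδ0 hmem'
  -- `D_Wμ = D_Wδ + D_Wμ_f`
  have hsplit : dirSq (gaugeDir W mu) (periodBox (d := d) (tower L N (j + 1)))
      ≤ 2 * dirSq (gaugeDir W δ) (periodBox (d := d) (tower L N (j + 1))) + 2 * dirSq (gaugeDir W mu_f) (periodBox (d := d) (tower L N (j + 1))) := by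
    unfold dirSq
    rw [Finset.mul_sum, Finset.mul_sum, ← Finset.sum_add_distrib]
    refine Finset.sum_le_sum fun y _ => ?_
    rw [Finset.mul_sum, Finset.mul_sum, ← Finset.sum_add_distrib]
    refine Finset.sum_le_sum fun κ _ => ?_
    have : gaugeDir W mu y κ = gaugeDir W δ y κ + gaugeDir W mu_f y κ := by rw [hgd]; abel
    rw [this]
    have hab := norm_add_le (gaugeDir W δ y κ) (gaugeDir W mu_f y κ)
    nlinarith [sq_nonneg (‖gaugeDir W δ y κ‖ - ‖gaugeDir W mu_f y κ‖), norm_nonneg (gaugeDir W δ y κ), norm_nonneg (gaugeDir W mu_f y κ),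
      norm_nonneg (gaugeDir W δ y κ + gaugeDir W mu_f y κ)]
  linarith [hcore]

include hL hWu hWP hx hsm hWx hmus hmuP hmu0 hmem in
omit hYff in
/-- **THE GENERAL RESIDUAL — `p₂`-SHAPE**: `Σ‖μ‖² ≤ 8·card n·M⁴·‖Y + D_Wμ_f‖_w² + 2·Σ‖μ_f‖²` (under the K6 smallness line). [folklore] -/
theorem sum_normSq_corrector_le_of_frameKill {mu_f : Site d → Matrix n n ℂ} (hfs : ∀ y, mu_f y ∈ skewAdjoint (Matrix n n ℂ))
    (hfP : ∀ (y : Site d) (i : Fin d), mu_f (y + ((tower L N (j + 1) : ℕ) : ℤ) • e i) = mu_f y)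
    (hf0 : ∀ w : Site d, mu_f (((L : ℤ) ^ (j + 1)) • w) = 0)
    (hff : ∀ z : Site d, framePotW L (j + 1) W (fun y ν => Y y ν + gaugeDir W mu_f y ν) z = 0)
    (hsmall : 8 * d * (((L : ℝ) ^ (j + 1)) * (((d : ℝ) - 1) * (((L : ℝ) ^ (j + 1)) - 1) * x)) ^ 2
      + 2 * (Fintype.card n * (4 * (d : ℝ) ^ 2 * ((L : ℝ) ^ (j + 1) - 1) ^ 2 * x + 16 * d * loopRad d L ((prop1Radius d L)^[j] x)) ^ 2) ≤ 1 / 2) :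
    ∑ z ∈ periodBox (d := d) (tower L N (j + 1)), ‖mu z‖ ^ 2
      ≤ 2 * (4 * (Fintype.card n : ℝ) * (((L : ℝ) ^ (j + 1)) ^ 2) ^ 2
            * energyNormW L (j + 1) W (fun y ν => Y y ν + gaugeDir W mu_f y ν) (periodBox (d := d) (tower L N (j + 1))) ^ 2)
        + 2 * ∑ z ∈ periodBox (d := d) (tower L N (j + 1)), ‖mu_f z‖ ^ 2 := by
  set δ : Site d → Matrix n n ℂ := fun y => mu y - mu_f y with hδ
  have hδs : ∀ y, δ y ∈ skewAdjoint (Matrix n n ℂ) := fun y => (skewAdjoint _).sub_mem (hmus y) (hfs y)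
  have hδP : ∀ (y : Site d) (i : Fin d), δ (y + ((tower L N (j + 1) : ℕ) : ℤ) • e i) = δ y := fun y i => by simp only [hδ, hmuP, hfP]
  have hδ0 : ∀ w : Site d, δ (((L : ℤ) ^ (j + 1)) • w) = 0 := fun w => by simp only [hδ, hmu0, hf0, sub_zero]
  have hgd : ∀ y κ, gaugeDir W δ y κ = gaugeDir W mu y κ - gaugeDir W mu_f y κ := fun y κ => by
    simp only [hδ, gaugeDir, T4AveragingDeficitWall.Ad, Matrix.mul_sub, Matrix.sub_mul]; abel
  have hmem' : (fun y ν => (fun y ν => Y y ν + gaugeDir W mu_f y ν) y ν + gaugeDir W δ y ν) ∈ frameFreeBlockLandauW (d := d) (n := n) L N (j + 1) W := by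
    have heq : (fun y ν => (fun y ν => Y y ν + gaugeDir W mu_f y ν) y ν + gaugeDir W δ y ν) = fun y ν => Y y ν + gaugeDir W mu y ν := by
      funext y ν; simp only [hgd]; abel
    rw [heq]; exact hmem
  have hcore := sum_normSq_corrector_le hL j hWu hWP hx hsm hWx hff hδs hδP hδ0 hmem' hsmall
  have hsplit : ∑ z ∈ periodBox (d := d) (tower L N (j + 1)), ‖mu z‖ ^ 2
      ≤ 2 * ∑ z ∈ periodBox (d := d) (tower L N (j + 1)), ‖δ z‖ ^ 2 + 2 * ∑ z ∈ periodBox (d := d) (tower L N (j + 1)), ‖mu_f z‖ ^ 2 := by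
    rw [Finset.mul_sum, Finset.mul_sum, ← Finset.sum_add_distrib]
    refine Finset.sum_le_sum fun z _ => ?_
    have : mu z = δ z + mu_f z := by simp only [hδ, sub_add_cancel]
    rw [this]
    have hab := norm_add_le (δ z) (mu_f z)
    nlinarith [sq_nonneg (‖δ z‖ - ‖mu_f z‖), norm_nonneg (δ z), norm_nonneg (mu_f z), norm_nonneg (δ z + mu_f z)]
  linarith [hcore]

end Class

end

end Summit.QuantumFields.BalabanUV.T4Continuum.NE7CorrectorEnergyMasses
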